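import Summits.SmoothPoincare4.SmoothPoincare4.Theorems.ShadowApproximation.Negative.ShadowsOnlyFalseFields

/-!
# Candidate proof of `stub_latticeIdentity` (line `epi-class-livingston`, crux stmt-SmoothPoincare4-14595)

drefute gen 3 (refuter): the registered stub 1a is TRUE; this file proves its statement verbatim
(`latticeIdentity`), via the abstract group lemma `commutator_le_of_cyclic_pairs`
(`C ⊔ A ⊔ B = ⊤`, `G ⧸ (C ⊔ B)` and `G ⧸ (C ⊔ A)` cyclic ⟹ `[G,G] ≤ C ⊔ (A ⊓ B)`;
centre-by-cyclic argument in `G ⧸ (C ⊔ (A ⊓ B))`). Positive content: evidence for a prover, not a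
refuter landing.
-/

noncomputable section

set_option linter.dupNamespace false

namespace Summit.SmoothPoincare4.SmoothPoincare4.Cruxes.ShadowApproximation.EpiClassLivingston.LatticeIdentity

open Literature.Topology.FourManifolds
open Summit.SmoothPoincare4.SmoothPoincare4.Theorems.ShadowApproximation.Negative

/-- Every element of `F₁` is a power of `t = of 0` (copy of the lemma in
`Negative/LevelSymmetriesFalse.lean`, kept local to keep the import light). [folklore] -/
theorem freeGroup_one_exists_zpow' (x : FreeGroup (Fin 1)) : ∃ n : ℤ, (FreeGroup.of 0) ^ n = x := by
  have hr : Set.range (FreeGroup.of : Fin 1 → FreeGroup (Fin 1)) = {FreeGroup.of 0} := by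
    ext y
    simp only [Set.mem_range, Set.mem_singleton_iff]
    constructor
    · rintro ⟨i, rfl⟩; rw [Fin.eq_zero i]
    · rintro rfl; exact ⟨0, rfl⟩
  have hx : x ∈ Subgroup.zpowers (FreeGroup.of 0 : FreeGroup (Fin 1)) := by
    rw [Subgroup.zpowers_eq_closure, ← hr, FreeGroup.closure_range_of]
    trivial
  exact Subgroup.mem_zpowers_iff.1 hx

/-- In `H ⊔ N` with `N` normal every element is `h * n`. [folklore] -/
theorem exists_mul_of_mem_sup {G : Type*} [Group G] {H N : Subgroup G} [N.Normal] {x : G}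
    (hx : x ∈ H ⊔ N) : ∃ h ∈ H, ∃ n ∈ N, h * n = x := by
  have hx' : x ∈ ((H ⊔ N : Subgroup G) : Set G) := hx
  rw [Subgroup.mul_normal] at hx'
  exact Set.mem_mul.1 hx'

/-- **Centre-by-cyclic lattice lemma.** For normal `A B C ≤ G` with `C ⊔ A ⊔ B = ⊤` and both
`G ⧸ (C ⊔ B)`, `G ⧸ (C ⊔ A)` cyclic (a generator given by an element of `G`), the commutator subgroup
lies in `C ⊔ (A ⊓ B)`. Proof: in `Q = G ⧸ (C ⊔ (A ⊓ B))` the images `Ā`, `B̄` commute elementwise,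
`Q = Ā B̄`, and `Ā ⊆ ⟨ā₀⟩·(Ā ∩ B̄)` with `Ā ∩ B̄` central, so `Ā` (and likewise `B̄`) is abelian,
hence `Q` is abelian. [folklore] -/
theorem commutator_le_of_cyclic_pairs {G : Type*} [Group G] (A B C : Subgroup G)
    [hA : A.Normal] [hB : B.Normal] [hC : C.Normal] (hgen : C ⊔ A ⊔ B = ⊤)
    (hcycA : ∃ x : G, ∀ g : G, ∃ n : ℤ, (x ^ n)⁻¹ * g ∈ C ⊔ B)
    (hcycB : ∃ x : G, ∀ g : G, ∃ n : ℤ, (x ^ n)⁻¹ * g ∈ C ⊔ A) :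
    ⁅(⊤ : Subgroup G), (⊤ : Subgroup G)⁆ ≤ C ⊔ (A ⊓ B) := by
  set T : Subgroup G := C ⊔ (A ⊓ B) with hT
  let f : G →* G ⧸ T := QuotientGroup.mk' T
  have hfT : ∀ g : G, f g = 1 ↔ g ∈ T := fun g => QuotientGroup.eq_one_iff g
  have hfC : ∀ c ∈ C, f c = 1 := fun c hc => (hfT c).2 (Subgroup.mem_sup_left hc)
  -- images of `A` and `B` commute
  have hfAB : ∀ a ∈ A, ∀ b ∈ B, f a * f b = f b * f a := by
    intro a ha b hb
    rw [← map_mul, ← map_mul, QuotientGroup.mk'_eq_mk']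
    refine ⟨b⁻¹ * a⁻¹ * b * a, Subgroup.mem_sup_right ⟨?_, ?_⟩, by group⟩
    · exact A.mul_mem (hA.conj_mem' _ (A.inv_mem ha) b) ha
    · have : b⁻¹ * a⁻¹ * b * a = b⁻¹ * (a⁻¹ * b * a) := by group
      rw [this]
      exact B.mul_mem (B.inv_mem hb) (hB.conj_mem' _ hb a)
  -- every element is `c * a * b`
  have hdec : ∀ g : G, ∃ c ∈ C, ∃ a ∈ A, ∃ b ∈ B, c * a * b = g := by
    intro g
    have hg : g ∈ C ⊔ A ⊔ B := hgen ▸ Subgroup.mem_top g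
    obtain ⟨y, hy, b, hb, rfl⟩ := exists_mul_of_mem_sup hg
    obtain ⟨c, hc, a, ha, rfl⟩ := exists_mul_of_mem_sup hy
    exact ⟨c, hc, a, ha, b, hb, rfl⟩
  -- a generator of `G ⧸ (C ⊔ B)` inside `A`, and of `G ⧸ (C ⊔ A)` inside `B`
  have hgenA : ∃ a₀ ∈ A, ∀ g : G, ∃ n : ℤ, (a₀ ^ n)⁻¹ * g ∈ C ⊔ B := by
    obtain ⟨x, hx⟩ := hcycA
    obtain ⟨c, hc, a, ha, b, hb, rfl⟩ := hdec x
    refine ⟨a, ha, fun g => ?_⟩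
    obtain ⟨n, hn⟩ := hx g
    refine ⟨n, ?_⟩
    have h1 : (QuotientGroup.mk (c * a * b) : G ⧸ (C ⊔ B)) = QuotientGroup.mk a := by
      rw [QuotientGroup.eq]
      have : (c * a * b)⁻¹ * a = b⁻¹ * (a⁻¹ * c⁻¹ * a) := by group
      rw [this]
      exact Subgroup.mul_mem _ (Subgroup.mem_sup_right (Subgroup.inv_mem _ hb))
        (Subgroup.mem_sup_left (hC.conj_mem' _ (C.inv_mem hc) a))
    have h2 : (QuotientGroup.mk ((c * a * b) ^ n) : G ⧸ (C ⊔ B)) = QuotientGroup.mk g := by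
      rw [QuotientGroup.eq]; exact hn
    rw [← QuotientGroup.eq, ← h2, QuotientGroup.mk_zpow, QuotientGroup.mk_zpow, h1]
  have hgenB : ∃ b₀ ∈ B, ∀ g : G, ∃ n : ℤ, (b₀ ^ n)⁻¹ * g ∈ C ⊔ A := by
    obtain ⟨x, hx⟩ := hcycB
    obtain ⟨c, hc, a, ha, b, hb, rfl⟩ := hdec x
    refine ⟨b, hb, fun g => ?_⟩
    obtain ⟨n, hn⟩ := hx g
    refine ⟨n, ?_⟩
    have h1 : (QuotientGroup.mk (c * a * b) : G ⧸ (C ⊔ A)) = QuotientGroup.mk b := by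
      rw [QuotientGroup.eq]
      have : (c * a * b)⁻¹ * b = b⁻¹ * (a⁻¹ * c⁻¹) * b := by group
      rw [this]
      exact (inferInstance : (C ⊔ A).Normal).conj_mem' _
        (Subgroup.mul_mem _ (Subgroup.mem_sup_right (Subgroup.inv_mem _ ha))
          (Subgroup.mem_sup_left (Subgroup.inv_mem _ hc))) b
    have h2 : (QuotientGroup.mk ((c * a * b) ^ n) : G ⧸ (C ⊔ A)) = QuotientGroup.mk g := by
      rw [QuotientGroup.eq]; exact hn
    rw [← QuotientGroup.eq, ← h2, QuotientGroup.mk_zpow, QuotientGroup.mk_zpow, h1]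
  -- `f A` is abelian
  have hfAA : ∀ a ∈ A, ∀ a' ∈ A, f a * f a' = f a' * f a := by
    obtain ⟨a₀, ha₀, hga⟩ := hgenA
    -- each `a ∈ A` has `f a = f a₀ ^ n * f b₁` with `b₁ ∈ B` and `f b₁ = f y`, `y ∈ A`
    have key : ∀ a ∈ A, ∃ n : ℤ, ∃ b₁ ∈ B, ∃ y ∈ A, f y = f b₁ ∧ f a = f a₀ ^ n * f b₁ := by
      intro a ha
      obtain ⟨n, hn⟩ := hga a
      obtain ⟨c₁, hc₁, b₁, hb₁, hcb⟩ := exists_mul_of_mem_sup hn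
      refine ⟨n, b₁, hb₁, (a₀ ^ n)⁻¹ * a, A.mul_mem (A.inv_mem (A.zpow_mem ha₀ n)) ha, ?_, ?_⟩
      · rw [← hcb, map_mul, hfC c₁ hc₁, one_mul]
      · have : a = a₀ ^ n * (c₁ * b₁) := by rw [hcb]; group
        rw [this, map_mul, map_mul, hfC c₁ hc₁, one_mul, map_zpow]
    intro a ha a' ha'
    obtain ⟨n, b₁, hb₁, y, hy, hyb, hfa⟩ := key a ha
    obtain ⟨m, b₂, hb₂, y', hy', hyb', hfa'⟩ := key a' ha'
    have c01 : Commute (f a₀) (f b₁) := hfAB a₀ ha₀ b₁ hb₁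
    have c02 : Commute (f a₀) (f b₂) := hfAB a₀ ha₀ b₂ hb₂
    have c12 : Commute (f b₁) (f b₂) := by
      show f b₁ * f b₂ = f b₂ * f b₁
      rw [← hyb]; exact hfAB y hy b₂ hb₂
    rw [hfa, hfa']
    calc f a₀ ^ n * f b₁ * (f a₀ ^ m * f b₂)
        = f a₀ ^ n * (f b₁ * f a₀ ^ m) * f b₂ := by group
      _ = f a₀ ^ n * (f a₀ ^ m * f b₁) * f b₂ := by rw [(c01.zpow_left m).symm.eq]
      _ = f a₀ ^ (n + m) * (f b₁ * f b₂) := by rw [zpow_add]; group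
      _ = f a₀ ^ (m + n) * (f b₂ * f b₁) := by rw [add_comm, c12.eq]
      _ = f a₀ ^ m * (f a₀ ^ n * f b₂) * f b₁ := by rw [zpow_add]; group
      _ = f a₀ ^ m * (f b₂ * f a₀ ^ n) * f b₁ := by rw [(c02.zpow_left n).eq]
      _ = f a₀ ^ m * f b₂ * (f a₀ ^ n * f b₁) := by group
  -- `f B` is abelian (symmetric argument)
  have hfBB : ∀ b ∈ B, ∀ b' ∈ B, f b * f b' = f b' * f b := by
    obtain ⟨b₀, hb₀, hgb⟩ := hgenB
    have key : ∀ b ∈ B, ∃ n : ℤ, ∃ a₁ ∈ A, ∃ y ∈ B, f y = f a₁ ∧ f b = f b₀ ^ n * f a₁ := by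
      intro b hb
      obtain ⟨n, hn⟩ := hgb b
      obtain ⟨c₁, hc₁, a₁, ha₁, hca⟩ := exists_mul_of_mem_sup hn
      refine ⟨n, a₁, ha₁, (b₀ ^ n)⁻¹ * b, B.mul_mem (B.inv_mem (B.zpow_mem hb₀ n)) hb, ?_, ?_⟩
      · rw [← hca, map_mul, hfC c₁ hc₁, one_mul]
      · have : b = b₀ ^ n * (c₁ * a₁) := by rw [hca]; group
        rw [this, map_mul, map_mul, hfC c₁ hc₁, one_mul, map_zpow]
    intro b hb b' hb'
    obtain ⟨n, a₁, ha₁, y, hy, hya, hfb⟩ := key b hb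
    obtain ⟨m, a₂, ha₂, y', hy', hya', hfb'⟩ := key b' hb'
    have c01 : Commute (f b₀) (f a₁) := (hfAB a₁ ha₁ b₀ hb₀).symm
    have c02 : Commute (f b₀) (f a₂) := (hfAB a₂ ha₂ b₀ hb₀).symm
    have c12 : Commute (f a₁) (f a₂) := by
      show f a₁ * f a₂ = f a₂ * f a₁
      rw [← hya]; exact (hfAB a₂ ha₂ y hy).symm
    rw [hfb, hfb']
    calc f b₀ ^ n * f a₁ * (f b₀ ^ m * f a₂)
        = f b₀ ^ n * (f a₁ * f b₀ ^ m) * f a₂ := by group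
      _ = f b₀ ^ n * (f b₀ ^ m * f a₁) * f a₂ := by rw [(c01.zpow_left m).symm.eq]
      _ = f b₀ ^ (n + m) * (f a₁ * f a₂) := by rw [zpow_add]; group
      _ = f b₀ ^ (m + n) * (f a₂ * f a₁) := by rw [add_comm, c12.eq]
      _ = f b₀ ^ m * (f b₀ ^ n * f a₂) * f a₁ := by rw [zpow_add]; group
      _ = f b₀ ^ m * (f a₂ * f b₀ ^ n) * f a₁ := by rw [(c02.zpow_left n).eq]
      _ = f b₀ ^ m * f a₂ * (f b₀ ^ n * f a₁) := by group
  -- hence the quotient is abelian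
  have hcomm : ∀ s t : G, f s * f t = f t * f s := by
    intro s t
    obtain ⟨c, hc, a, ha, b, hb, rfl⟩ := hdec s
    obtain ⟨c', hc', a', ha', b', hb', rfl⟩ := hdec t
    simp only [map_mul, hfC c hc, hfC c' hc', one_mul]
    calc f a * f b * (f a' * f b') = f a * (f b * f a') * f b' := by group
      _ = f a * (f a' * f b) * f b' := by rw [hfAB a' ha' b hb]
      _ = (f a * f a') * (f b * f b') := by group
      _ = (f a' * f a) * (f b' * f b) := by rw [hfAA a ha a' ha', hfBB b hb b' hb']
      _ = f a' * (f a * f b') * f b := by group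
      _ = f a' * (f b' * f a) * f b := by rw [hfAB a ha b' hb']
      _ = f a' * f b' * (f a * f b) := by group
  rw [Subgroup.commutator_le]
  intro s _ t _
  rw [← hfT, commutatorElement_def, map_mul, map_mul, map_mul, map_inv, map_inv, hcomm s t]
  group

/-- Distinct `i j l : Fin 3` exhaust `Fin 3`. [folklore] -/
theorem fin3_cover : ∀ i j l : Fin 3, i ≠ j → j ≠ l → i ≠ l → ∀ t : Fin 3, t = i ∨ t = j ∨ t = l := by
  decide

/-- **The lattice identity (stub 1a, verbatim):** for every `(3,1)` group trisection `K` of `{1}`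
and every labelling `{i,j,l} = {0,1,2}`, `[S,S] ≤ Kᵢ ⊔ (Kⱼ ⊓ Kₗ)`. Uses only `normal`, `triple`
(`K₀ ⊔ K₁ ⊔ K₂ = ⊤`) and `free_pairQuotient` (rank `1`, i.e. cyclic pair quotients). [folklore] -/
theorem latticeIdentity :
    ∀ K : TrisectionKernels 3, IsGroupTrisection 3 1 (PUnit : Type) K →
      ∀ i j l : Fin 3, i ≠ j → j ≠ l → i ≠ l →
        ⁅(⊤ : Subgroup (SurfaceGroup 3)), (⊤ : Subgroup (SurfaceGroup 3))⁆ ≤ K i ⊔ (K j ⊓ K l) := by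
  intro K hK i j l hij hjl hil
  haveI : ∀ t, (K t).Normal := hK.normal
  have hcover := fin3_cover i j l hij hjl hil
  -- `triple`: the three kernels generate
  have htop : K i ⊔ K j ⊔ K l = ⊤ := by
    obtain ⟨e⟩ := hK.triple
    rw [eq_top_iff]
    intro g _
    have h1 : (QuotientGroup.mk g : TrisectionKernels.tripleQuotient K) = 1 :=
      e.injective (Subsingleton.elim _ _)
    rw [QuotientGroup.eq_one_iff] at h1
    refine (Subgroup.normalClosure_le_normal ?_) h1
    intro x hx
    rw [Set.mem_iUnion] at hx
    obtain ⟨t, ht⟩ := hx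
    rcases hcover t with rfl | rfl | rfl
    · exact Subgroup.mem_sup_left (Subgroup.mem_sup_left ht)
    · exact Subgroup.mem_sup_left (Subgroup.mem_sup_right ht)
    · exact Subgroup.mem_sup_right ht
  -- `free_pairQuotient`: cyclic pair quotients
  have hcyc : ∀ p q : Fin 3, p ≠ q →
      ∃ x : SurfaceGroup 3, ∀ g : SurfaceGroup 3, ∃ n : ℤ, (x ^ n)⁻¹ * g ∈ K p ⊔ K q := by
    intro p q hpq
    obtain ⟨e⟩ := hK.free_pairQuotient p q hpq
    obtain ⟨x, hx⟩ := QuotientGroup.mk_surjective (e (FreeGroup.of 0))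
    refine ⟨x, fun g => ?_⟩
    obtain ⟨n, hn⟩ := freeGroup_one_exists_zpow' (e.symm (QuotientGroup.mk g))
    refine ⟨n, ?_⟩
    have h2 : (QuotientGroup.mk (x ^ n) : TrisectionKernels.pairQuotient K p q) =
        QuotientGroup.mk g := by
      rw [QuotientGroup.mk_zpow, hx, ← map_zpow, hn, MulEquiv.apply_symm_apply]
    rw [QuotientGroup.eq] at h2
    have hN : Subgroup.normalClosure ((K p : Set (SurfaceGroup 3)) ∪ K q) = K p ⊔ K q :=
      normalClosure_union_eq_sup (K p) (K q)
    rw [hN] at h2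
    exact h2
  exact commutator_le_of_cyclic_pairs (K j) (K l) (K i) htop (hcyc i l hil) (hcyc i j hij)

end Summit.SmoothPoincare4.SmoothPoincare4.Cruxes.ShadowApproximation.EpiClassLivingston.LatticeIdentity

end

-- shape check against the registered stub signature (namespaces as in the skeleton)
open Literature.Topology.FourManifolds in
example : ∀ K : TrisectionKernels 3, IsGroupTrisection 3 1 (PUnit : Type) K →
      ∀ i j l : Fin 3, i ≠ j → j ≠ l → i ≠ l →
        ⁅(⊤ : Subgroup (SurfaceGroup 3)), (⊤ : Subgroup (SurfaceGroup 3))⁆ ≤ K i ⊔ (K j ⊓ K l) :=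
  Summit.SmoothPoincare4.SmoothPoincare4.Cruxes.ShadowApproximation.EpiClassLivingston.LatticeIdentity.latticeIdentity
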